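import Summits.NavierStokesRegularity.NavierStokesRegularity.Theorems.CertifiedBlowupCertifiedBlowupAxisymBlowupBlowupSet
import Literature.Analysis.FluidPDE.CheskidovShvydkoyRegularProofs
import HarnessLib

/-!
# Witnesses of the crux `CertifiedBlowupAxisymBlowup` lie in no Ladyzhenskaya–Prodi–Serrin class

Theorems file landed `--supports stmt-NavierStokesRegularity-0727`, line `compact-amplification`
(continuation lead c4, wave 2; registered stub `not_memLqLp_of_isMaximalSmoothSolution`). A witness
of the crux is a viscosity `ν > 0`, a time `T > 0` and a maximal smooth solution `(u, p)` of the
unforced Navier–Stokes system of lifespan `T`, Leray–Hopf on `[0, T]` from its rapidly decaying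
axisymmetric datum `u 0`. This file proves, from PROVED tree theorems only, that the WHOLE
Ladyzhenskaya–Prodi–Serrin battery fails for every witness:
`u ∉ L^q(0, T; L^r(ℝ³))` whenever `3 < r ≤ ∞` and `2/q + 3/r ≤ 1` (exponents in `[0, ∞]`, so the
endpoint `r = ∞`, `q = 2` is included).

Proof: were `u ∈ L^q(0,T; L^r)`, the tree's discharged conditional regularity theorem
`ladyzhenskaya_prodi_serrin_holds` (Prodi 1959; Serrin 1962/63; Ladyzhenskaya 1967;
Robinson–Rodrigo–Sadowski 2016, Thm. 8.17) gives a classical representative `(v, p')` on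
`(0, T] × ℝ³` with `u t = v t` a.e. for every `t ∈ (0, T]`; both slices being continuous for
`t < T`, `u t = v t` on `(0, T)`. But `v` is jointly continuous up to and including `T`, hence
bounded on the compact `[T/2, T] × B̄(x₀, 1)` for every `x₀`, so `u` is bounded on a backward
parabolic neighbourhood of `(T, x₀)` for EVERY `x₀` — contradicting the landed nonemptiness of the
blow-up set of a witness (`exists_not_isBoundedNearTop_of_isMaximalSmoothSolution`).

No new definitions, no named-fact hypotheses, no `sorry`.

## References

* J. Serrin, *The initial value problem for the Navier–Stokes equations*, in: Nonlinear Problems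
  (Madison 1962), Univ. Wisconsin Press 1963, Thm. 6. [Serrin1963]
* G. Prodi, *Un teorema di unicità per le equazioni di Navier–Stokes*, Ann. Mat. Pura Appl. 48
  (1959), 173–182. [Prodi1959]
* J. C. Robinson, J. L. Rodrigo, W. Sadowski, *The Three-Dimensional Navier–Stokes Equations*,
  CUP 2016, Thm. 8.17 (with Lemma 8.16). [RobinsonRodrigoSadowski2016]
-/

-- the summit and its single problem share the name (D-0017 nested layout)
set_option linter.dupNamespace false

noncomputable section

open MeasureTheory Set Function Filter Topology Metric
open scoped ENNReal NNReal

namespace Summit.NavierStokesRegularity.NavierStokesRegularity.Theorems.CertifiedBlowupAxisymBlowup.CompactAmplification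

open Literature.Analysis Literature.Analysis.FluidPDE

section Witness

variable {ν T : ℝ} {u : ℝ → EuclideanSpace ℝ (Fin 3) → EuclideanSpace ℝ (Fin 3)}
  {p : ℝ → EuclideanSpace ℝ (Fin 3) → ℝ}

/-- **A classical representative up to and including `T` makes every point a point of local
boundedness at `T`.** If `u` is classical on `[0, T)` and agrees a.e., slice by slice on `(0, T]`,
with a classical solution `v` on `(0, T]`, then `u` is bounded on a backward parabolic
neighbourhood `(T - ρ², T) × B(x₀, ρ)` of `(T, x₀)` for every `x₀`: the continuous slices agree
everywhere on `(0, T)`, and `v` is jointly continuous on the compact `[T/2, T] × B̄(x₀, 1)`.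
[folklore] -/
theorem isBoundedNearTop_of_classical_representative_Ioc (hT : 0 < T)
    (hcl : IsClassicalNSSolutionOn (Ico 0 T) ν 0 u p)
    {v : ℝ → EuclideanSpace ℝ (Fin 3) → EuclideanSpace ℝ (Fin 3)}
    {p' : ℝ → EuclideanSpace ℝ (Fin 3) → ℝ} (hv : IsClassicalNSSolutionOn (Ioc 0 T) ν 0 v p')
    (hae : ∀ t ∈ Ioc 0 T, u t =ᵐ[volume] v t) (x₀ : EuclideanSpace ℝ (Fin 3)) :
    IsBoundedNearTop u T x₀ := by
  -- continuous slices that agree a.e. agree everywhere, for `t ∈ (0, T)`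
  have heq : ∀ t ∈ Ioo 0 T, u t = v t := fun t ht =>
    (Continuous.ae_eq_iff_eq volume (hcl.contDiff_velocity ⟨ht.1.le, ht.2⟩).continuous
      (hv.contDiff_velocity ⟨ht.1, ht.2.le⟩).continuous).1 (hae t ⟨ht.1, ht.2.le⟩)
  -- `v` is bounded on the compact `[T/2, T] × B̄(x₀, 1) ⊆ (0, T] × ℝ³`
  have hK : IsCompact (Icc (T / 2) T ×ˢ closedBall x₀ 1) :=
    isCompact_Icc.prod (isCompact_closedBall _ _)
  have hsub : Icc (T / 2) T ×ˢ closedBall x₀ 1 ⊆ Ioc 0 T ×ˢ (univ : Set (EuclideanSpace ℝ (Fin 3))) :=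
    prod_mono (fun t ht => ⟨by linarith [ht.1], ht.2⟩) (subset_univ _)
  obtain ⟨K, hKb⟩ := hK.exists_bound_of_continuousOn (hv.smooth_velocity.continuousOn.mono hsub)
  -- radius `ρ = min 1 (T/2)`: `ρ ≤ 1` and `ρ² ≤ ρ ≤ T/2`
  set ρ : ℝ := min 1 (T / 2) with hρ_def
  have hρ0 : 0 < ρ := lt_min one_pos (by linarith)
  have hρ1 : ρ ≤ 1 := min_le_left _ _
  have hρT : ρ ≤ T / 2 := min_le_right _ _
  have hρsq : ρ ^ 2 ≤ T / 2 := by nlinarith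
  refine ⟨ρ, hρ0, K, fun t ht x hx => ?_⟩
  have htI : t ∈ Ioo 0 T := ⟨by linarith [ht.1], ht.2⟩
  have htc : t ∈ Icc (T / 2) T := ⟨by linarith [ht.1], ht.2.le⟩
  have hxc : x ∈ closedBall x₀ 1 := by
    rw [mem_closedBall]
    exact ((mem_ball.1 hx).le).trans hρ1
  have h := hKb (t, x) (mk_mem_prod htc hxc)
  rw [heq t htI]
  simpa [uncurry] using h

end Witness

/-- **No witness of the crux lies in any Ladyzhenskaya–Prodi–Serrin class** (registered stub of
stmt-NavierStokesRegularity-0727; Prodi 1959, Serrin 1963 Thm. 6, Ladyzhenskaya 1967, in the modern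
form Robinson–Rodrigo–Sadowski 2016 Thm. 8.17 = the tree's discharged
`ladyzhenskaya_prodi_serrin_holds`): for a maximal Leray–Hopf classical solution `(u, p)` of
viscosity `ν > 0` and finite lifespan `T` from a rapidly decaying axisymmetric datum,
`u ∉ L^q(0, T; L^r(ℝ³))` for all exponents `q, r ∈ [0, ∞]` with `3 < r` and `2/q + 3/r ≤ 1`
(`r = ∞`, `q = 2` included). Otherwise `u` would have a classical representative on `(0, T] × ℝ³`,
making every `x₀` a point of local boundedness at `T`
(`isBoundedNearTop_of_classical_representative_Ioc`), against the nonempty blow-up set of a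
witness (`exists_not_isBoundedNearTop_of_isMaximalSmoothSolution`).
[cite: RobinsonRodrigoSadowski2016, Thm. 8.17] -/
theorem not_memLqLp_of_isMaximalSmoothSolution : ∀ {ν T : ℝ} {u : ℝ → EuclideanSpace ℝ (Fin 3) → EuclideanSpace ℝ (Fin 3)} {p : ℝ → EuclideanSpace ℝ (Fin 3) → ℝ}, 0 < ν → 0 < T → IsMaximalSmoothSolution ν 0 u p T → IsLerayHopfOn T ν 0 (u 0) u → HasRapidSpatialDecay (u 0) → IsAxisymmetric (u 0) → ∀ {q r : ENNReal}, 3 < r → 2 / q + 3 / r ≤ 1 → ¬ MemLqLp q r u (Set.Ioo 0 T) := by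
  intro ν T u p hν hT hmax hLH hdec haxi q r hr hqr hS
  obtain ⟨v, p', hv, hae⟩ := ladyzhenskaya_prodi_serrin_holds hν hT hLH hr hqr hS
  obtain ⟨x₀, hx₀⟩ := exists_not_isBoundedNearTop_of_isMaximalSmoothSolution hν hT hmax hLH hdec haxi
  exact hx₀ (isBoundedNearTop_of_classical_representative_Ioc hT hmax.1 hv hae x₀)

end Summit.NavierStokesRegularity.NavierStokesRegularity.Theorems.CertifiedBlowupAxisymBlowup.CompactAmplification

end
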